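import Summits.Ventures.DiscreteObjects.Hadamard.Order167CentralizerFree668

/-!
# H(668): the centraliser of an element of order 167 is ABELIAN (pair level; kernel)

Framing: lottery ticket; floor = certified bounds/negative ranges.

Cell pub-namedobj (venture DiscreteObjects), target (H), hadamard gen 21.  Consequence of `Order167CentralizerFree668`
(`hadamard668_order167_centralizer_sq_mem`: every `τ` centralising the signed automorphism `σ = (π, κ, d, e)` of pair order `167`
of an H(668) has `τ² ∈ ⟨σ⟩` at the pair level).  **`hadamard668_order167_centralizer_abelian`**: if `τ₁ = (π₁, κ₁, d₁, e₁)` and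
`τ₂ = (π₂, κ₂, d₂, e₂)` both commute with `σ` (pair level), then `π₁π₂ = π₂π₁` and `κ₁κ₂ = κ₂κ₁`.  [`commute_of_sq_central`: with
`τ₁² = σ^b`, `τ₂² = σ^c`, `(τ₁τ₂)² = σ^a` (all central): `σ^{b+c} τ₂τ₁ = σ^a τ₁τ₂`; computing `σ^{2(b+c)} τ₂τ₁τ₁` two ways gives
`σ^{2(b+c)} = σ^{2a}`, and `σ` has odd order, so `σ^{b+c} = σ^a` and `τ₂τ₁ = τ₁τ₂`.]  So the pair group of `C(σ)` is ABELIAN of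
order `167 · |C(σ) : ±⟨σ⟩| ∈ {167, 334, 668}` (gen 21: index `≤ 4`, exponent-`2` quotient): `C₁₆₇`, `C₃₃₄` or `C₂ × C₃₃₄` — paper
reading; at the signed level `C±(σ) ≅ C₁₆₇ × E₂` with `E₂ ∈ {C₂, C₄, Q₈}` need not be abelian (`Q₈`, the Williamson case).
STRUCTURE of a hypothetical object; H(668) untouched; HITS 0/4.  Ours; no `sorry`, no definitions, default heartbeats.
-/

namespace Summit.Ventures.DiscreteObjects.Hadamard

open Finset BigOperators Matrix

open Literature.Combinatorics.Designs.GoethalsSeidel (IsHadamardMatrix)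

variable {ι : Type*} [Fintype ι] [DecidableEq ι]

omit [Fintype ι] [DecidableEq ι] in
/-- `g^(2u) = g^(2a)` with `g^167 = 1` gives `g^u = g^a` (`167` is odd) -/
lemma pow_eq_pow_of_sq_167 {g : Equiv.Perm ι} (hg : g ^ 167 = 1) {u a : ℕ} (h : g ^ (2 * u) = g ^ (2 * a)) :
    g ^ u = g ^ a := by
  calc g ^ u = g ^ u * (g ^ 167) ^ u := by rw [hg, one_pow, mul_one]
    _ = (g ^ (2 * u)) ^ 84 := by rw [← pow_mul, ← pow_add, ← pow_mul]; congr 1; ring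
    _ = (g ^ (2 * a)) ^ 84 := by rw [h]
    _ = g ^ a * (g ^ 167) ^ a := by rw [← pow_mul, ← pow_mul, ← pow_add]; congr 1; ring
    _ = g ^ a := by rw [hg, one_pow, mul_one]

omit [Fintype ι] [DecidableEq ι] in
/-- **group-theoretic core**: `g^167 = 1`, `x, y` commute with `g`, `x² = g^b`, `y² = g^c`, `(xy)² = g^a` ⇒ `xy = yx` -/
lemma commute_of_sq_central {g x y : Equiv.Perm ι} (hg : g ^ 167 = 1) (hx : Commute x g) (hy : Commute y g) {a b c : ℕ}
    (hxx : x ^ 2 = g ^ b) (hyy : y ^ 2 = g ^ c) (hxy : (x * y) ^ 2 = g ^ a) : Commute x y := by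
  have hxp : ∀ n : ℕ, x * g ^ n = g ^ n * x := fun n => (hx.pow_right n).eq
  have hyp : ∀ n : ℕ, y * g ^ n = g ^ n * y := fun n => (hy.pow_right n).eq
  have hyxp : ∀ n : ℕ, y * x * g ^ n = g ^ n * (y * x) := fun n => ((hy.mul_left hx).pow_right n).eq
  -- (*)  g^(b+c) (y x) = g^a (x y)
  have hstar : g ^ (b + c) * (y * x) = g ^ a * (x * y) := by
    have h1 : x * (x * y) ^ 2 * y = x * g ^ a * y := by rw [hxy]
    have h2 : x * (x * y) ^ 2 * y = x ^ 2 * (y * x) * y ^ 2 := by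
      rw [pow_two, pow_two, pow_two]; simp only [mul_assoc]
    rw [h2, hxx, hyy, mul_assoc (g ^ b), hyxp c, ← mul_assoc, ← pow_add, hxp a] at h1
    rw [h1, mul_assoc]
  -- g^(b+c) g^(b+c) (y x) x computed two ways
  have hA : g ^ (b + c) * g ^ (b + c) * (y * x) * x = g ^ (2 * (b + c) + b) * y := by
    have e : y * x * x = g ^ b * y := by rw [mul_assoc, ← pow_two, hxx, hyp b]
    calc g ^ (b + c) * g ^ (b + c) * (y * x) * x = g ^ (b + c) * g ^ (b + c) * (y * x * x) := by simp only [mul_assoc]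
      _ = g ^ (b + c) * g ^ (b + c) * (g ^ b * y) := by rw [e]
      _ = g ^ ((b + c) + (b + c) + b) * y := by rw [← mul_assoc, ← pow_add, ← pow_add]
      _ = g ^ (2 * (b + c) + b) * y := by rw [two_mul]
  have hB : g ^ (b + c) * g ^ (b + c) * (y * x) * x = g ^ (2 * a + b) * y := by
    calc g ^ (b + c) * g ^ (b + c) * (y * x) * x = g ^ (b + c) * (g ^ (b + c) * (y * x)) * x := by simp only [mul_assoc]
      _ = g ^ (b + c) * (g ^ a * (x * y)) * x := by rw [hstar]
      _ = g ^ a * (g ^ (b + c) * x) * y * x := by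
          rw [← mul_assoc, ← pow_add, add_comm, pow_add]; simp only [mul_assoc]
      _ = g ^ a * (x * g ^ (b + c)) * y * x := by rw [hxp (b + c)]
      _ = g ^ a * x * (g ^ (b + c) * (y * x)) := by simp only [mul_assoc]
      _ = g ^ a * x * (g ^ a * (x * y)) := by rw [hstar]
      _ = g ^ a * (x * g ^ a) * x * y := by simp only [mul_assoc]
      _ = g ^ a * (g ^ a * x) * x * y := by rw [hxp a]
      _ = g ^ a * g ^ a * (x * x) * y := by simp only [mul_assoc]
      _ = g ^ (2 * a + b) * y := by rw [← pow_two x, hxx, ← pow_add, ← pow_add, two_mul]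
  have h2 : g ^ (2 * (b + c)) = g ^ (2 * a) := by
    have h := hA.symm.trans hB
    rw [pow_add, pow_add g (2 * a) b, mul_assoc, mul_assoc] at h
    exact mul_right_cancel h
  have hu : g ^ (b + c) = g ^ a := pow_eq_pow_of_sq_167 hg h2
  rw [hu] at hstar
  exact (mul_left_cancel hstar).symm

section main
variable {H : Matrix ι ι ℤ}

/-- **The centraliser of an element of order 167 is abelian (pair level).** -/
theorem hadamard668_order167_centralizer_abelian (hH : IsHadamardMatrix H) (hι : Fintype.card ι = 668)
    {π κ : Equiv.Perm ι} {d e : ι → ℤ} (haut : IsSignedAut H π κ d e)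
    (hπ : π ^ 167 = 1) (hκ : κ ^ 167 = 1) (hne : π ≠ 1 ∨ κ ≠ 1)
    {π₁ κ₁ π₂ κ₂ : Equiv.Perm ι} {d₁ e₁ d₂ e₂ : ι → ℤ} (h₁ : IsSignedAut H π₁ κ₁ d₁ e₁) (h₂ : IsSignedAut H π₂ κ₂ d₂ e₂)
    (hc₁ : Commute π₁ π) (hc₁' : Commute κ₁ κ) (hc₂ : Commute π₂ π) (hc₂' : Commute κ₂ κ) :
    Commute π₁ π₂ ∧ Commute κ₁ κ₂ := by
  obtain ⟨b, hb, hb'⟩ := hadamard668_order167_centralizer_sq_mem hH hι haut hπ hκ hne h₁ hc₁ hc₁'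
  obtain ⟨c, hc, hc'⟩ := hadamard668_order167_centralizer_sq_mem hH hι haut hπ hκ hne h₂ hc₂ hc₂'
  obtain ⟨a, ha, ha'⟩ := hadamard668_order167_centralizer_sq_mem hH hι haut hπ hκ hne (isSignedAut_mul h₁ h₂)
    (hc₁.mul_left hc₂) (hc₁'.mul_left hc₂')
  exact ⟨commute_of_sq_central hπ hc₁ hc₂ hb hc ha, commute_of_sq_central hκ hc₁' hc₂' hb' hc' ha'⟩

end main

end Summit.Ventures.DiscreteObjects.Hadamard
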